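import Summits.KontsevichZagierPeriods.KontsevichZagierPeriods.Theses.SymplecticScissors
import Literature.NumberTheory.Transcendental.AyoubPeriodSeries
import Literature.NumberTheory.Transcendental.AyoubPeriodSeriesPiAlgebraic
import Literature.NumberTheory.Transcendental.AyoubPeriodSeriesLocalizing
import Mathlib.RingTheory.MvPowerSeries.Rename
import Mathlib.RingTheory.PowerSeries.Binomial
import Mathlib.FieldTheory.AlgebraicClosure

/-!
# `TypeAGeneration` (stmt-KontsevichZagierPeriods-18392), line `Sketch`, stub
`stub_partialFractions_of` (PF-b): partial fractions in `ℂ[[z]]`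

Registered stub `stub_partialFractions_of` of the crux `TypeAGeneration` (route SymplecticScissors,
line `Sketch`), on top of `Literature/NumberTheory/Transcendental/AyoubPeriodSeries.lean`
(`AyoubRel.CSeries = ℂ[[z₀, z₁, …]]`) and `…AyoubPeriodSeriesLocalizing.lean` (`AyoubRel.axisEmb`,
renaming a one-variable series into the variable `zᵢ`).

**Statement.** GIVEN the germ calculus G2 (`stub_binGermCalculus`, a hypothesis here; only the
exponent law `(1 − zᵢ/α)^{a+b} = (1 − zᵢ/α)^a (1 − zᵢ/α)^b` and the exponents `0`, `1` are used, in
the form of the pole identity `(zᵢ − α) · p_α = 1`, `p_α := (−α⁻¹)(1 − zᵢ/α)⁻¹`): if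
`B(zᵢ) · F = A(zᵢ)` in `ℂ[[z]]` with `A, B ∈ ℚ̄[T]`, `B ≠ 0` and every complex root of `B` of
modulus `> 1`, then `F = P(zᵢ) + Σⱼ Σ_t c_{jt} p_{αⱼ}^{t+1}` with `P ∈ ℚ̄[T]`, `αⱼ ∈ ℚ̄` of modulus
`> 1` and `c_{jt} ∈ ℚ̄`.

**Proof.** Over the algebraically closed field `K = ℚ̄ = algebraicClosure ℚ ℂ` (to which `A`, `B`
lift), by induction on `deg B`, peeling one pole order at a time: if `B = c` is a constant,
`F = c⁻¹ A(zᵢ)`; otherwise pick a root `a` of `B` of multiplicity `k + 1`, `B = (T − a)^{k+1} B₁`,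
`B₁(a) ≠ 0`, put `c₀ := A(a)/B₁(a)`, `A − c₀ B₁ = (T − a) A₁`, `B' := (T − a)^k B₁`; then
`B'(zᵢ) · (F − c₀ p_a^{k+1}) = A₁(zᵢ)` (`pb_step`, using only `(zᵢ − a) p_a = 1`), and `deg B' < deg B`.
The pole germ enters only through `(zᵢ − α) p_α = 1`, so the induction is run for an abstract
family `q α` of inverses (`pb_core`).

Elementary (folklore); no definition is introduced (the germ is a local notation).
-/

noncomputable section

-- `Summit.KontsevichZagierPeriods.KontsevichZagierPeriods.…` is the tree's mandated layout (single-conjunct summit).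
set_option linter.dupNamespace false

namespace Summit.KontsevichZagierPeriods.KontsevichZagierPeriods.TypeAGenerationLine

open Finsupp MvPowerSeries
open Literature.NumberTheory.Transcendental
open Literature.NumberTheory.Transcendental.AyoubRel

/-- The binomial germ `(1 − zᵢ/α)^a ∈ ℂ[[z]]`. -/
local notation3 "binGerm[" i ", " α ", " a "]" =>
  (MvPowerSeries.rename (⇑(axisEmb i))
    (PowerSeries.rescale (-(α : ℂ)⁻¹) (PowerSeries.binomialSeries ℂ (a : ℂ)) : MvPowerSeries Unit ℂ) :
    CSeries)

/-! ## The pole germ `1/(zᵢ − α)` -/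

/-- **Pole identity** `(zᵢ − α) · (−α⁻¹)(1 − zᵢ/α)⁻¹ = 1` (`α ≠ 0`), from the exponent law and the
exponents `0`, `1` of the germ calculus. [folklore] -/
theorem pb_pole (i : ℕ) {α : ℂ} (hα : α ≠ 0)
    (hadd : ∀ a b : ℂ, binGerm[i, α, a + b] = binGerm[i, α, a] * binGerm[i, α, b])
    (h0 : binGerm[i, α, (0 : ℂ)] = 1) (h1 : binGerm[i, α, (1 : ℂ)] = 1 - C α⁻¹ * X i) :
    (X i - C α) * ((-α⁻¹) • binGerm[i, α, (-1 : ℂ)]) = 1 := by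
  have h := hadd 1 (-1)
  rw [add_neg_cancel, h0, h1] at h
  have hC : C α * C α⁻¹ = (1 : CSeries) := by rw [← map_mul, mul_inv_cancel₀ hα, map_one]
  calc (X i - C α) * ((-α⁻¹) • binGerm[i, α, (-1 : ℂ)])
      = (1 - C α⁻¹ * X i) * binGerm[i, α, (-1 : ℂ)] := by
        rw [smul_eq_C_mul, ← mul_assoc, map_neg]
        congr 1
        linear_combination hC
    _ = 1 := h.symm

/-! ## One peeling step, in a commutative ring -/

/-- **The peeling step.** In a commutative ring, if `L p = 1`, `L^{k+1} b F = a` and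
`L a₁ = a − c b`, then `L^k b (F − c p^{k+1}) = a₁`. [folklore] -/
theorem pb_step {R : Type*} [CommRing R] {L p a a₁ b F c : R} {k : ℕ} (h1 : L * p = 1)
    (hF : L ^ (k + 1) * b * F = a) (ha₁ : L * a₁ = a - c * b) :
    L ^ k * b * (F - c * p ^ (k + 1)) = a₁ := by
  have h2 : L ^ k * p ^ k = 1 := by rw [← mul_pow, h1, one_pow]
  linear_combination p * hF - (L ^ k * b * F - a₁) * h1 - c * b * p * h2 - p * ha₁

/-! ## Bookkeeping of the normal form `P(zᵢ) + Σⱼ Σ_t c_{jt} q_{αⱼ}^{t+1}` -/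

/-- Prepending one pole term `c₀ q_{α₀}^{k+1}` (`k < M`) to a double sum
`Σ_{j<m} Σ_{t<M} c_{jt} q_{αⱼ}^{t+1}`. [folklore] -/
theorem pb_cons {K : Type} [Field K] (ι : K →+* ℂ) (q : ℂ → CSeries) {M m : ℕ}
    (α : Fin m → K) (c : Fin m → Fin M → K) (α₀ c₀ : K) {k : ℕ} (hk : k < M) :
    (∑ j : Fin (m + 1), ∑ t : Fin M,
        ι (Matrix.vecCons (fun t : Fin M => if (t : ℕ) = k then c₀ else 0) c j t) •
          q (ι (Matrix.vecCons α₀ α j)) ^ ((t : ℕ) + 1)) =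
      ι c₀ • q (ι α₀) ^ (k + 1) + ∑ j, ∑ t : Fin M, ι (c j t) • q (ι (α j)) ^ ((t : ℕ) + 1) := by
  rw [Fin.sum_univ_succ]
  simp only [Matrix.cons_val_zero, Matrix.cons_val_succ]
  congr 1
  rw [Finset.sum_eq_single ⟨k, hk⟩]
  · rw [if_pos rfl]
  · intro t _ ht
    rw [if_neg (fun h => ht (Fin.ext h)), map_zero, zero_smul]
  · intro h
    exact absurd (Finset.mem_univ _) h

/-- The constant case: `B = b ≠ 0`, `F = b⁻¹ A(zᵢ)`. [folklore] -/
theorem pb_base {K : Type} [Field K] (ι : K →+* ℂ) (i : ℕ) (q : ℂ → CSeries) (M : ℕ)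
    (A B : Polynomial K) (F : CSeries) (hB0 : B ≠ 0) (hdeg : B.natDegree = 0)
    (hF : Polynomial.aeval (X i : CSeries) (B.map ι) * F =
      Polynomial.aeval (X i : CSeries) (A.map ι)) :
    ∃ (P : Polynomial K) (m : ℕ) (α : Fin m → K) (c : Fin m → Fin M → K),
      (∀ j, 1 < ‖ι (α j)‖) ∧
      F = Polynomial.aeval (X i : CSeries) (P.map ι) +
        ∑ j, ∑ t : Fin M, ι (c j t) • q (ι (α j)) ^ ((t : ℕ) + 1) := by
  obtain ⟨b, rfl⟩ : ∃ b, B = Polynomial.C b := ⟨_, Polynomial.eq_C_of_natDegree_eq_zero hdeg⟩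
  have hb : b ≠ 0 := fun h => hB0 (by rw [h, map_zero])
  have hιb : ι b ≠ 0 := (map_ne_zero ι).2 hb
  refine ⟨Polynomial.C b⁻¹ * A, 0, fun j => j.elim0, fun j => j.elim0, fun j => j.elim0, ?_⟩
  rw [Finset.univ_eq_empty, Finset.sum_empty, add_zero, Polynomial.map_mul, map_mul, ← hF,
    Polynomial.map_C, Polynomial.map_C, Polynomial.aeval_C, Polynomial.aeval_C,
    MvPowerSeries.algebraMap_apply, MvPowerSeries.algebraMap_apply, Algebra.algebraMap_self_apply,
    Algebra.algebraMap_self_apply, ← mul_assoc, ← map_mul, map_inv₀, inv_mul_cancel₀ hιb, map_one,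
    one_mul]

/-! ## The induction on `deg B` -/

/-- **Partial fractions, abstract form.** Over an algebraically closed field `K → ℂ`, with an
abstract family of inverses `(zᵢ − α) q_α = 1` (`‖α‖ > 1`): if `B ≠ 0`, `deg B ≤ n`, `deg B ≤ M`,
all roots of `B` map to modulus `> 1`, and `B(zᵢ) F = A(zᵢ)`, then
`F = P(zᵢ) + Σ_{j<m} Σ_{t<M} c_{jt} q_{αⱼ}^{t+1}`. [folklore] -/
theorem pb_core {K : Type} [Field K] [IsAlgClosed K] (ι : K →+* ℂ) (i : ℕ) (q : ℂ → CSeries)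
    (hq : ∀ α : K, 1 < ‖ι α‖ → (X i - C (ι α)) * q (ι α) = 1) (M : ℕ) :
    ∀ (n : ℕ) (A B : Polynomial K) (F : CSeries), B ≠ 0 → B.natDegree ≤ n → B.natDegree ≤ M →
      (∀ α : K, B.IsRoot α → 1 < ‖ι α‖) →
      Polynomial.aeval (X i : CSeries) (B.map ι) * F = Polynomial.aeval (X i : CSeries) (A.map ι) →
      ∃ (P : Polynomial K) (m : ℕ) (α : Fin m → K) (c : Fin m → Fin M → K),
        (∀ j, 1 < ‖ι (α j)‖) ∧
        F = Polynomial.aeval (X i : CSeries) (P.map ι) +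
          ∑ j, ∑ t : Fin M, ι (c j t) • q (ι (α j)) ^ ((t : ℕ) + 1) := by
  intro n
  induction n with
  | zero =>
    intro A B F hB0 hn _ _ hF
    exact pb_base ι i q M A B F hB0 (Nat.le_zero.1 hn) hF
  | succ n ih =>
    intro A B F hB0 hn hM hroots hF
    by_cases hle : B.natDegree ≤ n
    · exact ih A B F hB0 hle hM hroots hF
    -- `deg B = n + 1 ≥ 1`: pick a root `a`, of multiplicity `k + 1`
    have hdeg : B.degree ≠ 0 := fun h =>
      hle (by rw [Polynomial.natDegree_eq_zero_iff_degree_le_zero.2 h.le]; exact Nat.zero_le n)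
    obtain ⟨a, ha⟩ := IsAlgClosed.exists_root B hdeg
    have haα : 1 < ‖ι a‖ := hroots a ha
    obtain ⟨k, hk⟩ : ∃ k, B.rootMultiplicity a = k + 1 :=
      Nat.exists_eq_succ_of_ne_zero ((Polynomial.rootMultiplicity_pos hB0).2 ha).ne'
    set B₁ := B /ₘ (Polynomial.X - Polynomial.C a) ^ (k + 1) with hB₁
    have hBfac : (Polynomial.X - Polynomial.C a) ^ (k + 1) * B₁ = B := by
      rw [hB₁, ← hk]
      exact Polynomial.pow_mul_divByMonic_rootMultiplicity_eq B a
    have hB₁a : B₁.eval a ≠ 0 := by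
      rw [hB₁, ← hk]
      exact Polynomial.eval_divByMonic_pow_rootMultiplicity_ne_zero a hB0
    have hB₁0 : B₁ ≠ 0 := fun h => hB₁a (by rw [h, Polynomial.eval_zero])
    -- `c₀ := A(a)/B₁(a)`, `A − c₀ B₁ = (T − a) A₁`, `B' := (T − a)^k B₁`
    set c₀ := A.eval a / B₁.eval a with hc₀
    set A₁ := (A - Polynomial.C c₀ * B₁) /ₘ (Polynomial.X - Polynomial.C a) with hA₁
    have hAfac : (Polynomial.X - Polynomial.C a) * A₁ = A - Polynomial.C c₀ * B₁ := by
      rw [hA₁, Polynomial.mul_divByMonic_eq_iff_isRoot, Polynomial.IsRoot, Polynomial.eval_sub,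
        Polynomial.eval_mul, Polynomial.eval_C, hc₀, div_mul_cancel₀ _ hB₁a, sub_self]
    set B' := (Polynomial.X - Polynomial.C a) ^ k * B₁ with hB'
    have hXa0 : (Polynomial.X - Polynomial.C a) ^ k ≠ 0 :=
      pow_ne_zero _ (Polynomial.X_sub_C_ne_zero a)
    have hB'0 : B' ≠ 0 := mul_ne_zero hXa0 hB₁0
    have hB'deg : B'.natDegree + 1 = B.natDegree := by
      rw [hB', ← hBfac, Polynomial.natDegree_mul hXa0 hB₁0,
        Polynomial.natDegree_mul (pow_ne_zero _ (Polynomial.X_sub_C_ne_zero a)) hB₁0,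
        Polynomial.natDegree_pow, Polynomial.natDegree_pow, Polynomial.natDegree_X_sub_C]
      ring
    have hB'B : B = B' * (Polynomial.X - Polynomial.C a) := by
      rw [hB', mul_comm, ← mul_assoc, ← pow_succ', hBfac]
    have hroots' : ∀ β : K, B'.IsRoot β → 1 < ‖ι β‖ := fun β hβ =>
      hroots β (hβ.dvd ⟨_, hB'B⟩)
    -- transfer to `ℂ[[z]]` along `P ↦ P(zᵢ)`
    have hφ : ∀ P : Polynomial K, Polynomial.aeval (X i : CSeries)
        (((Polynomial.X - Polynomial.C a) * P).map ι) =
        (X i - C (ι a)) * Polynomial.aeval (X i : CSeries) (P.map ι) := by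
      intro P
      rw [Polynomial.map_mul, map_mul, Polynomial.map_sub, Polynomial.map_X, Polynomial.map_C,
        map_sub, Polynomial.aeval_X, Polynomial.aeval_C, MvPowerSeries.algebraMap_apply,
        Algebra.algebraMap_self_apply]
    have hφk : ∀ (l : ℕ) (P : Polynomial K), Polynomial.aeval (X i : CSeries)
        (((Polynomial.X - Polynomial.C a) ^ l * P).map ι) =
        (X i - C (ι a)) ^ l * Polynomial.aeval (X i : CSeries) (P.map ι) := by
      intro l P
      induction l with
      | zero => rw [pow_zero, one_mul, pow_zero, one_mul]
      | succ l ihl => rw [pow_succ', mul_assoc, hφ, ihl, ← mul_assoc, ← pow_succ']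
    have hF' : (X i - C (ι a)) ^ (k + 1) * Polynomial.aeval (X i : CSeries) (B₁.map ι) * F =
        Polynomial.aeval (X i : CSeries) (A.map ι) := by
      rw [← hφk, hBfac, hF]
    have hA₁' : (X i - C (ι a)) * Polynomial.aeval (X i : CSeries) (A₁.map ι) =
        Polynomial.aeval (X i : CSeries) (A.map ι) -
          C (ι c₀) * Polynomial.aeval (X i : CSeries) (B₁.map ι) := by
      rw [← hφ, hAfac, Polynomial.map_sub, map_sub, Polynomial.map_mul, map_mul, Polynomial.map_C,
        Polynomial.aeval_C, MvPowerSeries.algebraMap_apply, Algebra.algebraMap_self_apply]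
    have hstep : Polynomial.aeval (X i : CSeries) (B'.map ι) *
        (F - C (ι c₀) * q (ι a) ^ (k + 1)) = Polynomial.aeval (X i : CSeries) (A₁.map ι) := by
      rw [hB', hφk]
      exact pb_step (hq a haα) hF' hA₁'
    -- induction hypothesis for `(A₁, B', F − c₀ q_a^{k+1})`
    have hn' : B'.natDegree ≤ n := by omega
    have hM' : B'.natDegree ≤ M := by omega
    have hkM : k < M := by
      have : k + 1 ≤ B.natDegree := by
        rw [← hBfac, Polynomial.natDegree_mul (pow_ne_zero _ (Polynomial.X_sub_C_ne_zero a)) hB₁0,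
          Polynomial.natDegree_pow, Polynomial.natDegree_X_sub_C]
        omega
      omega
    obtain ⟨P, m, α, c, hα, hrep⟩ := ih A₁ B' _ hB'0 hn' hM' hroots' hstep
    refine ⟨P, m + 1, Matrix.vecCons a α,
      Matrix.vecCons (fun t : Fin M => if (t : ℕ) = k then c₀ else 0) c, ?_, ?_⟩
    · refine Fin.cases ?_ ?_
      · simpa using haα
      · intro j
        simpa using hα j
    · rw [pb_cons ι q α c a c₀ hkM, add_left_comm, ← hrep, smul_eq_C_mul, add_sub_cancel]

/-! ## Lifting `ℚ̄`-polynomials and the registered form -/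

/-- A complex polynomial with algebraic coefficients lifts to `ℚ̄ = algebraicClosure ℚ ℂ`.
[folklore] -/
theorem pb_lift (A : Polynomial ℂ) (hA : ∀ n, IsAlgebraic ℚ (A.coeff n)) :
    ∃ A₀ : Polynomial (algebraicClosure ℚ ℂ), A₀.map (algebraMap (algebraicClosure ℚ ℂ) ℂ) = A :=
  (Polynomial.mem_lifts A).1 ((Polynomial.lifts_iff_coeff_lifts A).2 fun n =>
    ⟨⟨A.coeff n, mem_algebraicClosure_iff.2 (hA n)⟩, rfl⟩)

/-- **PF-b — PARTIAL FRACTIONS IN `ℂ[[z]]`.** If `B·F = A` with `A, B ∈ ℚ̄[zᵢ]`, `B ≠ 0` and every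
root of `B` of modulus `> 1`, then `F` is a polynomial plus a `ℚ̄`-combination of the pole germs
`(zᵢ − αⱼ)^{−(t+1)} = ((−αⱼ⁻¹)(1 − zᵢ/αⱼ)⁻¹)^{t+1}`, `αⱼ` the roots of `B` (partial fractions over
the algebraically closed field `ℚ̄ ⊂ ℂ`, peeling one pole order at a time, and
`(zᵢ − α)·(−α⁻¹)(1 − zᵢ/α)⁻¹ = 1` from G2), GIVEN the germ calculus G2. [folklore] -/
theorem stub_partialFractions_of :
    (∀ (i : ℕ) (α : ℂ),
      (∀ (a : ℂ) (n : ℕ), MvPowerSeries.coeff (Finsupp.single i n) (binGerm[i, α, a]) =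
        Ring.choose a n * (-α⁻¹) ^ n) ∧
      (∀ (a : ℂ) (x : ℕ →₀ ℕ), (∀ n : ℕ, x ≠ Finsupp.single i n) →
        MvPowerSeries.coeff x (binGerm[i, α, a]) = 0) ∧
      (∀ a b : ℂ, binGerm[i, α, a + b] = binGerm[i, α, a] * binGerm[i, α, b]) ∧
      binGerm[i, α, (0 : ℂ)] = 1 ∧
      binGerm[i, α, (1 : ℂ)] = 1 - C α⁻¹ * X i ∧
      (∀ a : ℂ, pdz i (binGerm[i, α, a]) = (-(a * α⁻¹)) • binGerm[i, α, a - 1]) ∧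
      (∀ a : ℂ, restrC i 0 (binGerm[i, α, a]) = 1)) →
    ∀ (i : ℕ) (F : CSeries) (A B : Polynomial ℂ), B ≠ 0 → (∀ n, IsAlgebraic ℚ (A.coeff n)) →
      (∀ n, IsAlgebraic ℚ (B.coeff n)) → (∀ z : ℂ, B.IsRoot z → 1 < ‖z‖) →
      Polynomial.aeval (X i : CSeries) B * F = Polynomial.aeval (X i : CSeries) A →
      ∃ (P : Polynomial ℂ) (m M : ℕ) (α : Fin m → ℂ) (c : Fin m → Fin M → ℂ),
        (∀ n, IsAlgebraic ℚ (P.coeff n)) ∧ (∀ j, IsAlgebraic ℚ (α j) ∧ 1 < ‖α j‖) ∧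
        (∀ j t, IsAlgebraic ℚ (c j t)) ∧
        F = Polynomial.aeval (X i : CSeries) P +
          ∑ j, ∑ t : Fin M, c j t • ((-(α j)⁻¹) • binGerm[i, α j, (-1 : ℂ)]) ^ ((t : ℕ) + 1) := by
  intro hG2 i F A B hB0 hA hB hroots hF
  haveI : IsAlgClosed (algebraicClosure ℚ ℂ) := (algebraicClosure.isAlgClosure ℚ ℂ).isAlgClosed
  obtain ⟨A₀, hA₀⟩ := pb_lift A hA
  obtain ⟨B₀, hB₀⟩ := pb_lift B hB
  have hB₀0 : B₀ ≠ 0 := by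
    rintro rfl
    rw [Polynomial.map_zero] at hB₀
    exact hB0 hB₀.symm
  have hroots₀ : ∀ α : algebraicClosure ℚ ℂ, B₀.IsRoot α →
      1 < ‖algebraMap (algebraicClosure ℚ ℂ) ℂ α‖ := fun α hα =>
    hroots _ (hB₀ ▸ hα.map)
  have hq : ∀ α : algebraicClosure ℚ ℂ, 1 < ‖algebraMap (algebraicClosure ℚ ℂ) ℂ α‖ →
      (X i - C (algebraMap (algebraicClosure ℚ ℂ) ℂ α)) *
        (fun β : ℂ => (-β⁻¹) • binGerm[i, β, (-1 : ℂ)]) (algebraMap (algebraicClosure ℚ ℂ) ℂ α) =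
        1 := by
    intro α hα
    have hα0 : algebraMap (algebraicClosure ℚ ℂ) ℂ α ≠ 0 := fun h => by
      rw [h, norm_zero] at hα
      exact absurd hα (not_lt.2 zero_le_one)
    exact pb_pole i hα0 (hG2 i _).2.2.1 (hG2 i _).2.2.2.1 (hG2 i _).2.2.2.2.1
  obtain ⟨P, m, α, c, hα, hrep⟩ := pb_core (algebraMap (algebraicClosure ℚ ℂ) ℂ) i
    (fun β : ℂ => (-β⁻¹) • binGerm[i, β, (-1 : ℂ)]) hq B₀.natDegree B₀.natDegree A₀ B₀ F hB₀0
    le_rfl le_rfl hroots₀ (by rw [hA₀, hB₀]; exact hF)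
  refine ⟨P.map (algebraMap (algebraicClosure ℚ ℂ) ℂ), m, B₀.natDegree,
    fun j => algebraMap (algebraicClosure ℚ ℂ) ℂ (α j),
    fun j t => algebraMap (algebraicClosure ℚ ℂ) ℂ (c j t), ?_, ?_, ?_, hrep⟩
  · intro n
    rw [Polynomial.coeff_map]
    exact mem_algebraicClosure_iff.1 (P.coeff n).2
  · exact fun j => ⟨mem_algebraicClosure_iff.1 (α j).2, hα j⟩
  · exact fun j t => mem_algebraicClosure_iff.1 (c j t).2

end Summit.KontsevichZagierPeriods.KontsevichZagierPeriods.TypeAGenerationLine
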